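import Summits.BirchSwinnertonDyer.BirchSwinnertonDyer.Theorems.AdditiveKolyvaginRoadLevelSystemsCongruenceSocket
import Summits.BirchSwinnertonDyer.Rank1Residual.GaloisImage.SelmerLocalConditionTamagawaFree
import Summits.BirchSwinnertonDyer.BirchSwinnertonDyer.Theses.AdditiveKolyvaginRoad
import Literature.NumberTheory.EllipticCurves.LocalKummerIsotropyTransport
import HarnessLib

/-!
# Route `AdditiveKolyvaginRoad`, crux `LevelKolyvaginSystemsAdditive` (item stmt-BirchSwinnertonDyer-21396, KS′):
# THE TRANSFER SOCKET, v3 — (θK) at the Tamagawa-free places DISCHARGED, the plane binder moved to the lender,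
# and KS′ BY NAME from a TRANSFER DATUM
# (cell `pub/bsd-wall`, width seat `bsd-wall-akr-p2x-w3` g4; `--supports stmt-BirchSwinnertonDyer-21396`, helper; companion of
# `AdditiveKolyvaginRoadLevelSystemsCongruenceSocket` (w3 g2, p588599) — residual list (iv) of `Cruxes/…/SOCKETS-CONGRUENCE.md` C2∕C3)

WHY. The transfer-type crux lines on KS′ (survivor A of TRIAGE-r1: `depleted-shadow-transfer` ⊕ `pold-fusion-glue` ⊕
`epsilon-matched-retyping`) glue the level Kolyvagin system of a `p`-good LENDER `E₀` to `E` along a `Γ_K`-equivariant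
isomorphism of torsion POINTS `θ : E₀[p](K̄) ≃ E[p](K̄)`. The socket `nonempty_levelKolyvaginSystemP_of_torsionCongr` (p588599)
left, besides the lender's system `S₀`, the congruence data and the bottom transfer (A2), ONE cohomological binder: (θK) «the KUMMER
conditions of `E` and `E₀` correspond under `θ_*`» at every finite place `v` which divides `p` or is bad for one of the curves. Its
part at the BAD places `v ∤ p` («♠-type bookkeeping», listed NOT in the tree in SOCKETS-CONGRUENCE C2 (iv)) IS in the tree: at a
finite place `v ∤ p` whose local Tamagawa numbers `c_v(E⁄K)`, `c_v(E₀⁄K)` are prime to `p` — ANY reduction types — both Kummer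
conditions are «unramified at `v`» (Greenberg's Néron-component argument, Milne ADT I.3.8), and unramifiedness passes through `θ`
(`Rank1Residual.GaloisImage.InertiaDivisible.selmerLocalKer_iff_h1Equiv_of_not_dvd_localTamagawaNumber`, file
`Rank1Residual/GaloisImage/SelmerLocalConditionTamagawaFree`, theorems only). At a ♯ frame `p ∤ ∏_ℓ c_ℓ(E)` and every bad prime of
`E` splits in the Heegner field `K`, so `p ∤ c_v(E⁄K)` is the frame's own arithmetic; `p ∤ c_v(E₀⁄K)` is lender-side arithmetic.
So after this file the ONLY cohomological input a transfer line owes is (θK) AT THE PLACES ABOVE `p` — exactly the output of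
(T-A1p), the parity-forced three-Lagrangian switch (`AdditiveKolyvaginRoadLagrangianSwitch` p583063, `…LagrangianSwitchAtPJump`
p596759, `…OnePlaceLagrangian` p596184; sibling akr-p2x-w2 g3 holds its assembly). The switch needs the PLANE hypothesis
`#H¹(K_v, E[p]) = p²`, i.e. `E(K_v)[p] = 0` at `v ∣ p` (Tate's local Euler characteristic, proved in the tree; w3 g3's
`natCard_image_kummerOutside_single_eq` reads it as `#ker [p] = 1`); §2 moves that binder to the LENDER: rational `p`-torsion over
ANY `K`-field is an invariant of the Galois module `E[p]`, so `E₀(K_v)[p] = 0 ⟹ E(K_v)[p] = 0` — for a `p`-good non-anomalous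
lender at a split `v ∣ p` the former is Silverman VII.3.1 (`Literature….localTorsion_eq_zero_of_good_of_not_dvd_frobeniusTrace_sub_one`
over `ℚ_p`); this is the lemma `NoLocalPTorsionOfNonAnomalousShadow` of the card `depleted-shadow-transfer` §4, in `K_v`-currency.

WHAT (namespace `…Theorems.AdditiveKoly`; levels written `p ^ 1` to match the carrier's `Vp W K p`).
* §1 `h1Equiv_mem_selmerLocalKer_iff_of_not_dvd_localTamagawaNumber` — (θK) at a finite `v ∤ p` with `p ∤ c_v(E⁄K)`,
  `p ∤ c_v(E₀⁄K)`, in the socket's currency (`W, W₀` over `ℚ` base-changed to `K`, level `p ^ 1`): the tree theorem, re-keyed.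
* §2 `exists_ne_zero_nsmul_eq_zero_of_congr` ∕ `forall_nsmul_eq_zero_of_congr` ∕ `natCard_ker_nsmulAddMonoidHom_eq_one_of_congr` —
  for elliptic curves `V, V₀` over a field `K` of characteristic `0`, a `Γ_K`-equivariant `θ : V₀[n] ≃ V[n]` and ANY `K`-field `E`
  (a completion `K_v`): `V₀(E)` has a point of order dividing `n ≠ 0`, non-zero, iff `V(E)` has one; hence `V₀(E)[n] = 0 ⟹ V(E)[n] = 0`
  and `#ker([n] on V(E)) = 1`. Road: the tree's local torsion transfer `torsionTransferEquiv : V[n](K̄) ≃ (V⁄E)[n](Ē)`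
  (`Γ_E`-equivariant, `LocalKummerIsotropyTransport`), the inclusion `toGeomPoints` with `smul_toGeomPoints`, and Galois descent
  over the perfect field `E` (`exists_toGeomPoints_eq_of_forall_smul_eq`).
* §3 `nonempty_levelKolyvaginSystemP_of_torsionCongr_tamagawa` — THE SOCKET v3: p588599 with its binder (θK) SPLIT into (Tam)
  «`p ∤ c_v(E⁄K)` and `p ∤ c_v(E₀⁄K)` at the places `v ∤ p` bad for one of the curves» (arithmetic) and (θK)ₚ «the Kummer
  conditions correspond under `θ_*` at the places `v ∣ p`» (the load-bearing input); the good places are p588310's Gross (7.1).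
* §4 **`levelKolyvaginSystemsAdditive_of_transferDatum : TRANSFER-DATUM(∀ ♯ frame) → LevelKolyvaginSystemsAdditive`** — KS′ BY
  NAME (companion of w3 g3's `levelKolyvaginSystemsAdditive_of_seed_free` for survivor A; NO `PublishedInputs…` needed: the socket
  uses no duality). TRANSFER-DATUM at a frame and a complex conjugation `c`: a lender `W₀/ℚ` (elliptic, globally minimal) with
  `Dt₀, β₀`; `θ : E₀[p](K̄) ≃ E[p](K̄)` `Γ_K`-equivariant and commuting with a lift `τ` of `c`; (rad) `rad(pN) = rad(pN₀)`;
  (a) `a_q(E) ≡ a_q(E₀) (mod p)` off `pN`; (Tam); (θK)ₚ; (S₀) `Nonempty (LevelKolyvaginSystemP W₀ K p Dt₀ β₀ ι c)` (W. Zhang 2014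
  for a `p`-good ordinary lender — in print, not typed); (A2) the bottom transfer of Kolyvagin non-vanishing (the ideas' content).

HONEST FRAMING: theorems only; 0 definitions, 0 named facts, 0 `sorry`; CONDITIONAL on the displayed binders; E-side glue; closes
nothing. Reach unchanged (frames with a congruent lender carrying a level system). The crux's open content — (A2), the lender's
system in tree currency, (θK)ₚ = (T-A1p), and for non-transfer lines K1 at `p²`-level and the seed — is untouched. BSD is not
proved by any of this.

References: [cite: MilneADT2006, Ch. I Prop. 3.8, Remark 3.10] [cite: GreenbergLNM1716, §3 Lemma 3.3 (p. 87) and the remark after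
its proof (p. 88)] [cite: CremonaMazur2000, §3] [cite: MazurRubin2004, §2.3] [cite: SilvermanAEC2009, VII.3 Prop. 3.1, VIII.§1
(proof of Prop. 1.2), X.§4] [cite: SerreGaloisCohomology1997, I §2.4, II §1.1] [cite: WZhang2014, Thm. 4.3, Lemma 5.1, Thm. 7.2,
§9] [cite: GrossLMS1991, §7 (7.1)] [cite: KrizLi2019, Thm. 1.16] [cite: PoonenRains2012, Prop. 4.10, Prop. 4.11].
-/

-- single-conjunct summit: `Summit.BirchSwinnertonDyer.BirchSwinnertonDyer.…` repeats the name by design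
set_option linter.dupNamespace false

noncomputable section

open scoped Classical

namespace Summit.BirchSwinnertonDyer.BirchSwinnertonDyer.Theorems.AdditiveKoly

open WeierstrassCurve NumberField IsDedekindDomain Field
  Literature.NumberTheory.EllipticCurves Literature.NumberTheory.EllipticCurves.ModularForms
  Literature.NumberTheory.GaloisRepresentations Module

/-! ## §2 Rational `n`-torsion over a `K`-field is an invariant of the Galois module `E[n]` -/

section TorsionTransport

variable {K : Type} [Field K] [CharZero K] (V V₀ : WeierstrassCurve K) [V.IsElliptic] [V₀.IsElliptic]
  (E : Type) [Field E] [Algebra K E] [CharZero E] {n : ℕ} (hn : n ≠ 0)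
  (θ : geomTorsion V₀ (n : ℤ) ≃+ geomTorsion V (n : ℤ))
  (hθ : ∀ (g : absoluteGaloisGroup K) (P : geomTorsion V₀ (n : ℤ)), θ (g • P) = g • θ P)
include hn hθ

/-- **Rational torsion of order dividing `n` is an invariant of the Galois module `E[n]` — over ANY `K`-field.** For elliptic
curves `V₀, V` over a field `K` of characteristic `0`, a `Γ_K`-equivariant additive isomorphism `θ : V₀[n](K̄) ≃ V[n](K̄)`
(`n ≠ 0`) and a field `E ⊇ K` (typically a completion `K_v`): if `V₀(E)` has a NON-ZERO point killed by `n`, so has `V(E)`.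
Proof: transport `θ` to a `Γ_E`-equivariant `θ_E : (V₀⁄E)[n](Ē) ≃ (V⁄E)[n](Ē)` along the tree's `torsionTransferEquiv` (both
sides); an `E`-rational `P` is a `Γ_E`-fixed geometric torsion point (`smul_toGeomPoints`), so is `θ_E P ≠ 0`, which descends to
`V(E)` (`exists_toGeomPoints_eq_of_forall_smul_eq`, `E` perfect). [cite: SilvermanAEC2009, VIII.§1 (proof of Prop. 1.2:
E(K̄)^{Γ_K} = E(K))] [cite: SerreGaloisCohomology1997, II §1.1] -/
theorem exists_ne_zero_nsmul_eq_zero_of_congr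
    (h₀ : ∃ P : (V₀.baseChange E).toAffine.Point, P ≠ 0 ∧ n • P = 0) :
    ∃ Q : (V.baseChange E).toAffine.Point, Q ≠ 0 ∧ n • Q = 0 := by
  obtain ⟨P, hP0, hPn⟩ := h₀
  have hnz : ((n : ℕ) : ℤ) ≠ 0 := Int.natCast_ne_zero.mpr hn
  -- the local torsion isomorphism `θ_E : (E₀⁄E)[n](Ē) ≃ (E⁄E)[n](Ē)`, `Γ_E`-equivariant
  let θE : geomTorsion (V₀.baseChange E) (n : ℤ) ≃+ geomTorsion (V.baseChange E) (n : ℤ) :=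
    ((V₀.torsionTransferEquiv (E := E) hnz).symm.trans θ).trans (V.torsionTransferEquiv (E := E) hnz)
  have hθE : ∀ (σ : absoluteGaloisGroup E) (S : geomTorsion (V₀.baseChange E) (n : ℤ)),
      θE (σ • S) = σ • θE S := by
    intro σ S
    simp only [θE, AddEquiv.trans_apply]
    rw [torsionTransferEquiv_symm_smul, hθ, torsionTransferEquiv_smul]
  -- `P` as a `Γ_E`-fixed geometric `n`-torsion point of `E₀⁄E`
  have hPmem : toGeomPoints (V₀.baseChange E) P ∈ geomTorsion (V₀.baseChange E) (n : ℤ) := by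
    rw [AddSubgroup.torsionBy.nsmul_iff, ← map_nsmul, hPn, map_zero]
  set Pg : geomTorsion (V₀.baseChange E) (n : ℤ) := ⟨toGeomPoints (V₀.baseChange E) P, hPmem⟩ with hPg
  have hPg0 : Pg ≠ 0 := by
    intro h
    apply hP0
    apply toGeomPoints_injective (V₀.baseChange E)
    rw [map_zero]
    exact congrArg Subtype.val h
  have hPgfix : ∀ σ : absoluteGaloisGroup E, σ • Pg = Pg := fun σ ↦
    Subtype.ext (by rw [AddSubgroup.torsionBy.coe_smul]; exact smul_toGeomPoints (V₀.baseChange E) σ P)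
  -- its image under `θ_E`: a non-zero `Γ_E`-fixed geometric `n`-torsion point of `E⁄E`
  have hQg0 : θE Pg ≠ 0 := fun h ↦ hPg0 (by rwa [map_eq_zero_iff θE θE.injective] at h)
  have hQgfix : ∀ σ : absoluteGaloisGroup E, σ • (θE Pg : geomPoints (V.baseChange E)) = θE Pg := fun σ ↦ by
    rw [← AddSubgroup.torsionBy.coe_smul, ← hθE, hPgfix]
  -- Galois descent over the perfect field `E`
  obtain ⟨Q, hQ⟩ := exists_toGeomPoints_eq_of_forall_smul_eq (V.baseChange E) hQgfix
  refine ⟨Q, fun h ↦ hQg0 (Subtype.ext ?_), ?_⟩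
  · rw [← hQ, h, map_zero]; rfl
  · apply toGeomPoints_injective (V.baseChange E)
    rw [map_nsmul, hQ, map_zero]
    exact AddSubgroup.torsionBy.nsmul_iff.mp (θE Pg).2

/-- **THE PLANE BINDER MOVED TO THE LENDER: `V₀(E)[n] = 0 ⟹ V(E)[n] = 0`** for a `Γ_K`-equivariant `θ : V₀[n](K̄) ≃ V[n](K̄)`
and any `K`-field `E` (apply the previous theorem to `θ⁻¹`). USE (transfer lines on KS′, (T-A1p)): `V = E⁄K`, `V₀ = E₀⁄K` the
`p`-good lender, `E = K_v` for `v ∣ p`; for a split `v` and a non-anomalous lender the hypothesis is Silverman VII.3.1 with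
`#Ẽ₀(𝔽_p) = p + 1 − a_p(E₀) ≢ 0` (tree, over `ℚ_p`: `Literature….localTorsion_eq_zero_of_good_of_not_dvd_frobeniusTrace_sub_one`)
— the lemma `NoLocalPTorsionOfNonAnomalousShadow` of the card `depleted-shadow-transfer` §4 in `K_v`-currency.
[cite: SilvermanAEC2009, VII.3 Prop. 3.1 and VIII.§1] -/
theorem forall_nsmul_eq_zero_of_congr
    (h₀ : ∀ P : (V₀.baseChange E).toAffine.Point, n • P = 0 → P = 0) :
    ∀ Q : (V.baseChange E).toAffine.Point, n • Q = 0 → Q = 0 := by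
  intro Q hQn
  by_contra hQ0
  have hθ' : ∀ (g : absoluteGaloisGroup K) (P : geomTorsion V (n : ℤ)), θ.symm (g • P) = g • θ.symm P := by
    intro g P
    apply θ.injective
    rw [θ.apply_symm_apply, hθ, θ.apply_symm_apply]
  obtain ⟨P, hP0, hPn⟩ := exists_ne_zero_nsmul_eq_zero_of_congr V₀ V E hn θ.symm hθ' ⟨Q, hQ0, hQn⟩
  exact hP0 (h₀ P hPn)

/-- **`#ker([n] : V(E) → V(E)) = 1` from `V₀(E)[n] = 0` along `θ`** — the counting form consumed at `v ∣ p` by w3 g3's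
`natCard_image_kummerOutside_single_eq` (p596184: `#Λ_v = #E(K_v)[p] · #(𝓞_v ⧸ p)`), hence the PLANE count `#H¹(K_v, E[p]) = p²`
at a place of degree one above `p` (Tate's local Euler characteristic, proved in the tree). [cite: SilvermanAEC2009, VII.3 Prop. 3.1
and VIII.§1] [cite: MilneADT2006, Ch. I Thm. 2.8] -/
theorem natCard_ker_nsmulAddMonoidHom_eq_one_of_congr
    (h₀ : ∀ P : (V₀.baseChange E).toAffine.Point, n • P = 0 → P = 0) :
    Nat.card (nsmulAddMonoidHom n : (V.baseChange E).toAffine.Point →+ (V.baseChange E).toAffine.Point).ker = 1 := by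
  have h := forall_nsmul_eq_zero_of_congr V V₀ E hn θ hθ h₀
  have hbot : (nsmulAddMonoidHom n : (V.baseChange E).toAffine.Point →+ (V.baseChange E).toAffine.Point).ker = ⊥ :=
    (AddSubgroup.eq_bot_iff_forall _).mpr fun Q hQ ↦ h Q (by rwa [AddMonoidHom.mem_ker, nsmulAddMonoidHom_apply] at hQ)
  rw [hbot, AddSubgroup.card_bot]

end TorsionTransport

/-! ## §1 (θK) at the Tamagawa-free places prime to `p`, in the socket's currency -/

section TamagawaPlaces

variable {K : Type} [Field K] [NumberField K] (W W₀ : WeierstrassCurve ℚ) [W.IsElliptic] [W₀.IsElliptic]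
  (p : ℕ) [Fact p.Prime]
  (θ : geomTorsion (W₀.baseChange K) ((p ^ 1 : ℕ) : ℤ) ≃+ geomTorsion (W.baseChange K) ((p ^ 1 : ℕ) : ℤ))
  (hθ : ∀ (g : absoluteGaloisGroup K) (P : geomTorsion (W₀.baseChange K) ((p ^ 1 : ℕ) : ℤ)), θ (g • P) = g • θ P)

/-- **(θK) AT A TAMAGAWA-FREE PLACE `v ∤ p`, socket currency.** For elliptic curves `E = W`, `E₀ = W₀` over `ℚ`, a number field
`K`, a `Γ_K`-equivariant `θ : E₀[p](K̄) ≃ E[p](K̄)` (level written `p ^ 1`) and a finite place `v ∤ p` of `K` — ANY reduction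
types — with `p ∤ c_v(E⁄K)` and `p ∤ c_v(E₀⁄K)`: a class `y ∈ H¹(K, E₀[p])` satisfies E₀'s Kummer condition at `v` iff `θ_* y`
satisfies E's. This is the tree theorem `InertiaDivisible.selmerLocalKer_iff_h1Equiv_of_not_dvd_localTamagawaNumber` (both
conditions are «unramified at `v`»: Greenberg's Néron-component road + Milne ADT I.3.8; unramifiedness passes through `θ`), re-keyed
to the prime `p ^ 1`. At good places `c_v = 1`, so this contains p588310's `h1Equiv_mem_selmerLocalKer_iff_of_hasGoodReductionAt`.
[cite: MilneADT2006, Ch. I Prop. 3.8 and Remark 3.10] [cite: GreenbergLNM1716, §3 Lemma 3.3 (p. 87) with the remark after its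
proof (p. 88)] [cite: CremonaMazur2000, §3] [cite: MazurRubin2004, §2.3] -/
theorem h1Equiv_mem_selmerLocalKer_iff_of_not_dvd_localTamagawaNumber {v : HeightOneSpectrum (𝓞 K)}
    (hpv : (p : 𝓞 K) ∉ v.asIdeal)
    (hc : ¬ p ∣ ((W.baseChange K).baseChange (v.adicCompletion K)).localTamagawaNumber (v.adicCompletionIntegers K))
    (hc₀ : ¬ p ∣ ((W₀.baseChange K).baseChange (v.adicCompletion K)).localTamagawaNumber (v.adicCompletionIntegers K))
    (y : galH1Torsion (W₀.baseChange K) ((p ^ 1 : ℕ) : ℤ)) :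
    h1Equiv θ hθ y ∈ selmerLocalKer (W.baseChange K) (v.adicCompletion K) ((p ^ 1 : ℕ) : ℤ) ↔
      y ∈ selmerLocalKer (W₀.baseChange K) (v.adicCompletion K) ((p ^ 1 : ℕ) : ℤ) := by
  haveI : Fact (p ^ 1).Prime := ⟨by rw [pow_one]; exact Fact.out⟩
  have hpv' : ((p ^ 1 : ℕ) : 𝓞 K) ∉ v.asIdeal := by rwa [pow_one]
  have hc' : ¬ p ^ 1 ∣ ((W.baseChange K).baseChange (v.adicCompletion K)).localTamagawaNumber
      (v.adicCompletionIntegers K) := by rwa [pow_one]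
  have hc₀' : ¬ p ^ 1 ∣ ((W₀.baseChange K).baseChange (v.adicCompletion K)).localTamagawaNumber
      (v.adicCompletionIntegers K) := by rwa [pow_one]
  exact (Rank1Residual.GaloisImage.InertiaDivisible.selmerLocalKer_iff_h1Equiv_of_not_dvd_localTamagawaNumber
    (W.baseChange K) (p ^ 1) (W₀.baseChange K) θ hθ v hpv' hc' hc₀' y).symm

end TamagawaPlaces

/-! ## §3 The socket, v3: (θK) asked only above `p` -/

section Socket

variable (W W₀ : WeierstrassCurve ℚ) (K : Type) [Field K] [NumberField K] (p : ℕ)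
  [W.IsGloballyMinimal] [W₀.IsGloballyMinimal] (c : K ≃ₐ[ℚ] K)
  [Module (ZMod p) (Vp W K p)] [Module (ZMod p) (Vp W₀ K p)]
  [W.IsElliptic] [W₀.IsElliptic] [Fact p.Prime] [NeZero (W.conductorNorm ℤ)] [NeZero (W₀.conductorNorm ℤ)]

/-- **LEVEL KOLYVAGIN SYSTEMS TRANSFER ALONG A TORSION CONGRUENCE — SOCKET v3.** Frame: `K` imaginary quadratic, Heegner for
`N_E`, `4N ∣ β² − d_K`, complex conjugation `c` with a lift `τ` to `K̄`. Lender: `E₀ = W₀` with `Dt₀, β₀` and a level Kolyvagin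
system `S₀`. Bridge: a `Γ_K`-equivariant additive isomorphism `θ` of the `p`-torsion points commuting with `τ`; (rad) `pN` and
`pN₀` with the same prime support; (a) `a_q(E) ≡ a_q(E₀) (mod p)` for the primes `q ∤ pN`; **(Tam)** `p ∤ c_v(E⁄K)` and
`p ∤ c_v(E₀⁄K)` at the finite places `v ∤ p` where one of the curves has bad reduction (ARITHMETIC — replaces the cohomological
(θK) there, §1); **(θK)ₚ** E's and E₀'s Kummer conditions identified under `θ_*` at the places ABOVE `p` ONLY (the load-bearing
input of the transfer ideas, = the output of the three-Lagrangian switch (T-A1p)). Glue: (A2) the bottom transfer of Kolyvagin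
non-vanishing. THEN `LevelKolyvaginSystemP W K p Dt β ι c` is inhabited — w3 g2's `nonempty_levelKolyvaginSystemP_of_torsionCongr`
(p588599) with (θK) at the bad places prime to `p` discharged. [cite: WZhang2014, Thm. 4.3, Thm. 7.2, §9]
[cite: MilneADT2006, Ch. I Prop. 3.8 and Remark 3.10] [cite: CremonaMazur2000, §3] [cite: KrizLi2019, Thm. 1.16] -/
theorem nonempty_levelKolyvaginSystemP_of_torsionCongr_tamagawa
    (Dt : ModularParametrizationData W (W.conductorNorm ℤ)) (β : ℤ) (ι : K →+* ℂ)
    (Dt₀ : ModularParametrizationData W₀ (W₀.conductorNorm ℤ)) (β₀ : ℤ)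
    (hK : IsImaginaryQuadratic K) (hH : SatisfiesHeegnerHypothesis (W.conductorNorm ℤ) K)
    (hβ : (4 * (W.conductorNorm ℤ : ℤ)) ∣ β ^ 2 - NumberField.discr K)
    (θ : geomTorsion (W₀.baseChange K) ((p ^ 1 : ℕ) : ℤ) ≃+ geomTorsion (W.baseChange K) ((p ^ 1 : ℕ) : ℤ))
    (hθ : ∀ (g : absoluteGaloisGroup K) (P : geomTorsion (W₀.baseChange K) ((p ^ 1 : ℕ) : ℤ)), θ (g • P) = g • θ P)
    {τ : AlgebraicClosure K ≃+* AlgebraicClosure K} (hτ : IsLiftOfAut c τ)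
    (hθτ : ∀ P : geomTorsion (W₀.baseChange K) ((p ^ 1 : ℕ) : ℤ),
      θ (hτ.torsionMap W₀ ((p ^ 1 : ℕ) : ℤ) P) = hτ.torsionMap W ((p ^ 1 : ℕ) : ℤ) (θ P))
    (hrad : ∀ q : ℕ, q.Prime → (q ∣ p * W.conductorNorm ℤ ↔ q ∣ p * W₀.conductorNorm ℤ))
    (ha : ∀ q : ℕ, q.Prime → ¬ q ∣ p * W.conductorNorm ℤ → (p : ℤ) ∣ W.frobeniusTrace q - W₀.frobeniusTrace q)
    (hTam : ∀ v : HeightOneSpectrum (𝓞 K), (p : 𝓞 K) ∉ v.asIdeal →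
      ¬ ((W.baseChange K).HasGoodReductionAt v ∧ (W₀.baseChange K).HasGoodReductionAt v) →
      ¬ p ∣ ((W.baseChange K).baseChange (v.adicCompletion K)).localTamagawaNumber (v.adicCompletionIntegers K) ∧
      ¬ p ∣ ((W₀.baseChange K).baseChange (v.adicCompletion K)).localTamagawaNumber (v.adicCompletionIntegers K))
    (hθKp : ∀ v : HeightOneSpectrum (𝓞 K), (p : 𝓞 K) ∈ v.asIdeal →
      ∀ y : Vp W₀ K p, h1Equiv θ hθ y ∈ selmerLocalKer (W.baseChange K) (v.adicCompletion K) ((p ^ 1 : ℕ) : ℤ) ↔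
        y ∈ selmerLocalKer (W₀.baseChange K) (v.adicCompletion K) ((p ^ 1 : ℕ) : ℤ))
    (S₀ : LevelKolyvaginSystemP W₀ K p Dt₀ β₀ ι c)
    (hA2 : (∃ (m₀ : Finset {ℓ // Zhang2014.IsKolyvaginPrime (W₀.conductorNorm ℤ) W₀ K p ℓ})
        (d₀ : KolyvaginHeegnerData Dt₀ β₀ ι (∏ ℓ ∈ m₀, (ℓ : ℕ))), d₀.kolyvaginClass (Fact.out : p.Prime) 1 ≠ 0) →
      ∃ (m : Finset {ℓ // Zhang2014.IsKolyvaginPrime (W.conductorNorm ℤ) W K p ℓ})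
        (d : KolyvaginHeegnerData Dt β ι (∏ ℓ ∈ m, (ℓ : ℕ))), d.kolyvaginClass (Fact.out : p.Prime) 1 ≠ 0) :
    Nonempty (LevelKolyvaginSystemP W K p Dt β ι c) := by
  refine nonempty_levelKolyvaginSystemP_of_torsionCongr W W₀ K p c Dt β ι Dt₀ β₀ hK hH hβ θ hθ hτ hθτ hrad ha
    (fun v hv y ↦ ?_) S₀ hA2
  by_cases hpv : (p : 𝓞 K) ∈ v.asIdeal
  · exact hθKp v hpv y
  · have hgood : ¬ ((W.baseChange K).HasGoodReductionAt v ∧ (W₀.baseChange K).HasGoodReductionAt v) :=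
      fun h ↦ hv ⟨h.1, h.2, hpv⟩
    obtain ⟨hc, hc₀⟩ := hTam v hpv hgood
    exact h1Equiv_mem_selmerLocalKer_iff_of_not_dvd_localTamagawaNumber W W₀ p θ hθ hpv hc hc₀ y

end Socket

/-! ## §4 KS′ BY NAME from a TRANSFER DATUM at every ♯ frame -/

section ByName

open Summit.BirchSwinnertonDyer.BirchSwinnertonDyer.Theses.AdditiveKolyvaginRoad
  Literature.NumberTheory.EllipticCurves.Rank1Residual

/-- **KS′ BY NAME FROM A TRANSFER DATUM** (the located-A of the transfer lines `depleted-shadow-transfer` ∕ `pold-fusion-glue` ∕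
`epsilon-matched-retyping`, survivor A of TRIAGE-r1). At every ♯ additive frame of the crux (binders VERBATIM) and every complex
conjugation `c ≠ 1` let there be a TRANSFER DATUM: a lender `W₀/ℚ` (elliptic, globally minimal, `N₀ ≠ 0`, with the `𝔽_p`-structure
on `H¹(K, E₀[p])`), a parametrisation `Dt₀` and orientation `β₀`; a `Γ_K`-equivariant `θ : E₀[p](K̄) ≃ E[p](K̄)` commuting with
a lift `τ` of `c` (θτ); (rad) `rad(pN) = rad(pN₀)`; (a) `a_q(E) ≡ a_q(E₀) (mod p)` off `pN`; (Tam) `p ∤ c_v(E⁄K)`, `p ∤ c_v(E₀⁄K)`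
at the bad places `v ∤ p` (for `E` this is the frame's `p ∤ ∏ c_ℓ` read at the split places of `K`); (θK)ₚ the Kummer conditions
agree under `θ_*` above `p` (= (T-A1p)); (S₀) a level Kolyvagin system of the LENDER at the frame (W. Zhang 2014, Thms 4.3/7.2/9.1,
in print for a `p`-good ordinary lender with ♠ — not typed in the tree); (A2) the bottom transfer «some Kolyvagin class of `E₀` is
non-zero mod `p` ⟹ some Kolyvagin class of `E` is» (the ideas' OPEN content: Kriz–Li-type congruences of Heegner classes). THEN the
crux `LevelKolyvaginSystemsAdditive` holds. Proof: unfold the crux and feed §3 frame by frame. No published-input bundle is used (the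
socket needs no duality). CONDITIONAL on the datum; credits nothing. [cite: WZhang2014, Thm. 4.3, Thm. 7.2, Thm. 9.1, §9]
[cite: KrizLi2019, Thm. 1.16] [cite: CremonaMazur2000, §3] [cite: MilneADT2006, Ch. I Prop. 3.8] -/
theorem levelKolyvaginSystemsAdditive_of_transferDatum
    (H : ∀ (W : WeierstrassCurve ℚ) [W.IsElliptic] [W.IsGloballyMinimal] [NeZero (W.conductorNorm ℤ)]
      (p : ℕ) [Fact p.Prime] (K : Type) [Field K] [NumberField K]
      (Dt : ModularParametrizationData W (W.conductorNorm ℤ)) (β : ℤ) (ι : K →+* ℂ),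
      5 ≤ p → Addv W p → W.HasSurjectiveModNGaloisRep p →
      (∀ (ℓ : ℕ) [Fact ℓ.Prime], W.HasMultiplicativeReductionAtPrime ℓ →
        ¬ p ∣ padicValInt ℓ W.minimalDiscriminantInt) →
      (∃ (ℓ₁ ℓ₂ : ℕ) (_ : Fact ℓ₁.Prime) (_ : Fact ℓ₂.Prime), ℓ₁ ≠ ℓ₂ ∧
        W.HasMultiplicativeReductionAtPrime ℓ₁ ∧ W.HasMultiplicativeReductionAtPrime ℓ₂) →
      ¬ p ∣ W.tamagawaProduct → W.analyticRank = 1 →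
      IsImaginaryQuadratic K → Odd (NumberField.discr K) → NumberField.discr K < -4 →
      SatisfiesHeegnerHypothesis (W.conductorNorm ℤ) K →
      (W.quadraticTwist (NumberField.discr K : ℚ)).entireLFunction 1 ≠ 0 →
      (4 * (W.conductorNorm ℤ : ℤ)) ∣ β ^ 2 - NumberField.discr K → ¬ (p : ℤ) ∣ Dt.c →
      ∀ (c : K ≃ₐ[ℚ] K), c ≠ 1 → ∀ [Module (ZMod p) (Vp W K p)],
      ∃ (W₀ : WeierstrassCurve ℚ) (_ : W₀.IsElliptic) (_ : W₀.IsGloballyMinimal) (_ : NeZero (W₀.conductorNorm ℤ))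
        (_ : Module (ZMod p) (Vp W₀ K p))
        (Dt₀ : ModularParametrizationData W₀ (W₀.conductorNorm ℤ)) (β₀ : ℤ)
        (θ : geomTorsion (W₀.baseChange K) ((p ^ 1 : ℕ) : ℤ) ≃+ geomTorsion (W.baseChange K) ((p ^ 1 : ℕ) : ℤ))
        (hθ : ∀ (g : absoluteGaloisGroup K) (P : geomTorsion (W₀.baseChange K) ((p ^ 1 : ℕ) : ℤ)),
          θ (g • P) = g • θ P)
        (τ : AlgebraicClosure K ≃+* AlgebraicClosure K) (hτ : IsLiftOfAut c τ),
        -- (θτ) `θ` commutes with the lift `τ` of `c` on torsion points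
        (∀ P : geomTorsion (W₀.baseChange K) ((p ^ 1 : ℕ) : ℤ),
          θ (hτ.torsionMap W₀ ((p ^ 1 : ℕ) : ℤ) P) = hτ.torsionMap W ((p ^ 1 : ℕ) : ℤ) (θ P)) ∧
        -- (rad) `pN` and `pN₀` have the same prime support
        (∀ q : ℕ, q.Prime → (q ∣ p * W.conductorNorm ℤ ↔ q ∣ p * W₀.conductorNorm ℤ)) ∧
        -- (a) `a_q(E) ≡ a_q(E₀) (mod p)` off `pN`
        (∀ q : ℕ, q.Prime → ¬ q ∣ p * W.conductorNorm ℤ → (p : ℤ) ∣ W.frobeniusTrace q - W₀.frobeniusTrace q) ∧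
        -- (Tam) `p ∤ c_v(E⁄K) · c_v(E₀⁄K)` at the bad places `v ∤ p`
        (∀ v : HeightOneSpectrum (𝓞 K), (p : 𝓞 K) ∉ v.asIdeal →
          ¬ ((W.baseChange K).HasGoodReductionAt v ∧ (W₀.baseChange K).HasGoodReductionAt v) →
          ¬ p ∣ ((W.baseChange K).baseChange (v.adicCompletion K)).localTamagawaNumber (v.adicCompletionIntegers K) ∧
          ¬ p ∣ ((W₀.baseChange K).baseChange (v.adicCompletion K)).localTamagawaNumber
            (v.adicCompletionIntegers K)) ∧
        -- (θK)ₚ THE LOAD-BEARING INPUT: the Kummer conditions agree ABOVE `p`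
        (∀ v : HeightOneSpectrum (𝓞 K), (p : 𝓞 K) ∈ v.asIdeal →
          ∀ y : Vp W₀ K p, h1Equiv θ hθ y ∈ selmerLocalKer (W.baseChange K) (v.adicCompletion K) ((p ^ 1 : ℕ) : ℤ) ↔
            y ∈ selmerLocalKer (W₀.baseChange K) (v.adicCompletion K) ((p ^ 1 : ℕ) : ℤ)) ∧
        -- (S₀) the lender's level Kolyvagin system
        Nonempty (LevelKolyvaginSystemP W₀ K p Dt₀ β₀ ι c) ∧
        -- (A2) the bottom transfer of Kolyvagin non-vanishing
        ((∃ (m₀ : Finset {ℓ // Zhang2014.IsKolyvaginPrime (W₀.conductorNorm ℤ) W₀ K p ℓ})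
            (d₀ : KolyvaginHeegnerData Dt₀ β₀ ι (∏ ℓ ∈ m₀, (ℓ : ℕ))), d₀.kolyvaginClass (Fact.out : p.Prime) 1 ≠ 0) →
          ∃ (m : Finset {ℓ // Zhang2014.IsKolyvaginPrime (W.conductorNorm ℤ) W K p ℓ})
            (d : KolyvaginHeegnerData Dt β ι (∏ ℓ ∈ m, (ℓ : ℕ))), d.kolyvaginClass (Fact.out : p.Prime) 1 ≠ 0)) :
    LevelKolyvaginSystemsAdditive := by
  intro W _ _ _ p _ K _ _ Dt β ι h5 hadd hsurj hsp htwo htam hr hK hodd hlt hH hL hβ hcM c hc1 _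
  obtain ⟨W₀, _, _, _, _, Dt₀, β₀, θ, hθ, τ, hτ, hθτ, hrad, ha, hTam, hθKp, ⟨S₀⟩, hA2⟩ :=
    H W p K Dt β ι h5 hadd hsurj hsp htwo htam hr hK hodd hlt hH hL hβ hcM c hc1
  exact nonempty_levelKolyvaginSystemP_of_torsionCongr_tamagawa W W₀ K p c Dt β ι Dt₀ β₀ hK hH hβ θ hθ hτ hθτ hrad
    ha hTam hθKp S₀ hA2

end ByName

end Summit.BirchSwinnertonDyer.BirchSwinnertonDyer.Theorems.AdditiveKoly

end
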